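import Summits.BirchSwinnertonDyer.BirchSwinnertonDyer.Theorems.EisensteinPrimesFullDescentLemmaS
import Literature.NumberTheory.EllipticCurves.MultiplicativeUnipotentTorsionProofs
import Literature.NumberTheory.EllipticCurves.MultiplicativeUnramifiedTorsionProofs
import HarnessLib

/-!
# Route `EisensteinPrimes`, crux 2 `GoodLatticeBDPValue` (stmt-BirchSwinnertonDyer-19032), line `halves` v21, stub 3a-B
# `stub_fullDescentAtThreeOfRed`, brick F6 completed: **at a multiplicative place `v ∤ N` the inertia groups of `Γ_K` act
# unipotently on `E[N]`, hence trivially on every rational `N`-line; so the character of a rational `N`-line of a curve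
# `E/ℚ` with good or multiplicative reduction at every `v ∤ N` is a power of the mod `N` cyclotomic character** (Lemma S′,
# split AND non-split primes, no Tate curve)

Cell `bsd-eis` (home `run/shared/lean/pub/bsd-eis/`), width seat `bsd-line-x1-p1-w2` (gen 5; `--supports -19032`, closes
nothing by itself). The local input of `FullDescentLemmaS.exists_lineCharacter_eq_pow` (sibling file, F6 of the AN-3 road memo
`HOME/line-x1-p1-w3-g4/AN3-StubB-elementary-road.md`) is DISCHARGED from the tree's Tate-curve-free unipotence theorem
`WeierstrassCurve.smul_smul_sub_eq_of_mem_inertia_of_hasMultiplicativeReductionAt` (`MultiplicativeUnipotentTorsionProofs`: at a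
multiplicative `v ∤ p`, split or not, every element of the LOCAL inertia group satisfies `(τ − 1)² = 0` on `E(K̄_v)[p^n]`):

* `smul_smul_sub_eq_of_mem_inertia_geomPoints` — the GLOBAL form: for a prime `𝔓 ∣ v` of `\bar ℤ_K` and `τ ∈ I_𝔓 ≤ Γ_K`,
  `τ (τ P − P) = τ P − P` for every `P ∈ E(K̄)` with `p^n P = O` (lift `τ` to the local inertia group along an embedding
  `K̄ → K̄_v` cutting out `𝔓`, Neukirch II (9.6) — the glue of the tree's
  `smul_eq_of_mem_inertia_of_hasMultiplicativeReductionAt_of_dvd_of_nsmul_eq_zero`, verbatim);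
* `smul_smul_sub_eq_of_mem_inertia_geomTorsion` — the same on `E[p]`;
* `lineCharacter_eq_one_of_unipotent` — a unipotent `τ` acts trivially on a stable line: `τ P = r(τ) P`, `(τ − 1)² P = 0`,
  `P ≠ 0` of prime order ⟹ `r(τ) = 1`;
* **`exists_lineCharacter_eq_pow_of_good_or_mult`** — `E/ℚ`, `⟨P⟩ ≤ E[N]` a rational line with character `r`, GOOD OR
  MULTIPLICATIVE reduction at every place `v ∤ N` ⟹ `r = χ̄_N^k` (`FullDescentLemmaS.exists_eq_modNCyclotomicCharacter_pow_of_exists_inertia`);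
* **`lineCharacter_three_dichotomy_of_good_or_mult`** — `N = 3`: `r = 𝟙` or `r = χ̄₃`.

HONEST FRAMING: helper theorems only (0 definitions, 0 named facts, 0 sorry); no summit statement, no BSD / IMC2 /
Keller–Yin theorem, no stub of the registered skeleton is proved here. References: [SilvermanATAEC1994] V.4–V.5, Ex. 5.13 (b);
[SerreInventiones1972] §1.12; [Mazur1978] §5 Lemma 5.2–5.3; [NeukirchANT1999] Ch. II §9 Prop. (9.6).
-/

set_option autoImplicit false
-- the route's Theorems namespace repeats the summit name by design (D-0017 nested layout)
set_option linter.dupNamespace false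

noncomputable section

open scoped Classical NNReal NumberField Pointwise

namespace Summit.BirchSwinnertonDyer.BirchSwinnertonDyer.Theorems.FullDescentMultiplicativeUnipotentLine

open Function NumberField IsDedekindDomain Field WeierstrassCurve
  Literature.NumberTheory.GaloisRepresentations Literature.NumberTheory.EllipticCurves
  Summit.BirchSwinnertonDyer.BirchSwinnertonDyer.Theorems.FullDescentLemmaS

universe u

/-! ## §1. Global unipotence of inertia at a multiplicative place `v ∤ p` -/

/-- **At a multiplicative place `v ∤ p` the inertia groups of `Γ_K` act unipotently on `E(K̄)[p^n]`** (global form of the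
tree's `WeierstrassCurve.smul_smul_sub_eq_of_mem_inertia_of_hasMultiplicativeReductionAt`): for `E/K` elliptic over a number
field, `v` a place of multiplicative reduction (split or not), `p` prime with `v ∤ p`, `n ≥ 1`, `𝔓` a prime of `\bar ℤ_K`
above `v` and `τ ∈ I_𝔓 ≤ Γ_K`: `τ (τ P − P) = τ P − P` for every `P ∈ E(K̄)` with `p^n P = O`. The local element is lifted
along an embedding `K̄ → K̄_v` cutting out `𝔓` (`exists_mem_inertia_apply_eq_holds`) and the identity transported along the
injective equivariant `pointsMapOfEmb`. [cite: SilvermanATAEC1994, V.4–V.5 and Exercise 5.13 (b)]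
[cite: SerreInventiones1972, §1.12] [cite: NeukirchANT1999, Ch. II §9 Prop. (9.6)] -/
theorem smul_smul_sub_eq_of_mem_inertia_geomPoints {K : Type u} [Field K] [NumberField K]
    {v : HeightOneSpectrum (𝓞 K)} (W : WeierstrassCurve K) [W.IsElliptic]
    (hmult : W.HasMultiplicativeReductionAt v) {p : ℕ} (hp : p.Prime) (hpv : (p : 𝓞 K) ∉ v.asIdeal)
    {n : ℕ} (hn : 1 ≤ n) {𝔓 : Ideal (absIntegers (𝓞 K) K)} (h𝔓 : 𝔓 ∈ v.primesAbove)
    {τ : absoluteGaloisGroup K} (hτ : τ ∈ 𝔓.inertia (absoluteGaloisGroup K))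
    {P : geomPoints W} (hP : p ^ n • P = 0) : τ • (τ • P - P) = τ • P - P := by
  obtain ⟨w, hw⟩ := v.exists_spectralValuation
  obtain ⟨𝔐, h𝔐⟩ := v.localPrimesAbove_nonempty
  -- arrange `𝔓 = 𝔓_{ι,𝔐}` for an embedding `ι : K̄ → K̄_v`
  obtain ⟨g, hg⟩ := HeightOneSpectrum.exists_smul_eq_of_mem_primesAbove_holds
    (HeightOneSpectrum.primeBelow_mem_primesAbove
      (ι := closureEmb (K := K) (v.adicCompletion K)) h𝔐) h𝔓
  set ι : AlgebraicClosure K →ₐ[K] AlgebraicClosure (v.adicCompletion K) :=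
    (closureEmb (K := K) (v.adicCompletion K)).comp
      ((show AlgebraicClosure K ≃ₐ[K] AlgebraicClosure K from g⁻¹) :
        AlgebraicClosure K →ₐ[K] AlgebraicClosure K) with hι
  have h1 : 𝔓 = v.primeBelow ι 𝔐 := by
    rw [hι, HeightOneSpectrum.primeBelow_comp, ← hg]
    exact congrArg (· • _) (inv_inv g).symm
  rw [h1] at hτ
  -- lift `τ ∈ I_𝔓` to the local inertia group `I_𝔐 ≤ Γ_{K_v}`
  obtain ⟨σ, hσI, hσ⟩ :=
    IsDedekindDomain.HeightOneSpectrum.exists_mem_inertia_apply_eq_holds v ι h𝔐 hτ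
  have hres : resGalOfEmb ι σ = τ := resGalOfEmb_eq_of_apply_eq ι hσ
  have hequiv : ∀ Q : geomPoints W, pointsMapOfEmb W ι (τ • Q) = σ • pointsMapOfEmb W ι Q := fun Q ↦ by
    rw [← hres]
    exact pointsMapOfEmb_smul W ι σ Q
  have hloc := W.smul_smul_sub_eq_of_mem_inertia_of_hasMultiplicativeReductionAt hmult hp hpv hn hw h𝔐 hσI
    (pointsMapOfEmb W ι P) (by rw [← map_nsmul, hP, map_zero])
  apply pointsMapOfEmb_injective W ι
  simp only [map_sub, hequiv]
  exact hloc

/-- **The same on `E[p] = geomTorsion W p`** (`n = 1`). [cite: SilvermanATAEC1994, V.4–V.5 and Exercise 5.13 (b)]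
[cite: SerreInventiones1972, §1.12] -/
theorem smul_smul_sub_eq_of_mem_inertia_geomTorsion {K : Type u} [Field K] [NumberField K]
    {v : HeightOneSpectrum (𝓞 K)} (W : WeierstrassCurve K) [W.IsElliptic]
    (hmult : W.HasMultiplicativeReductionAt v) {p : ℕ} (hp : p.Prime) (hpv : (p : 𝓞 K) ∉ v.asIdeal)
    {𝔓 : Ideal (absIntegers (𝓞 K) K)} (h𝔓 : 𝔓 ∈ v.primesAbove)
    {τ : absoluteGaloisGroup K} (hτ : τ ∈ 𝔓.inertia (absoluteGaloisGroup K))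
    (P : geomTorsion W (p : ℤ)) : τ • (τ • P - P) = τ • P - P := by
  apply Subtype.ext
  simp only [AddSubgroup.torsionBy.coe_smul, AddSubgroupClass.coe_sub]
  refine smul_smul_sub_eq_of_mem_inertia_geomPoints W hmult hp hpv (n := 1) le_rfl h𝔓 hτ ?_
  rw [pow_one, ← natCast_zsmul]
  exact (Submodule.mem_torsionBy_iff (p : ℤ) P.1).mp P.2

/-! ## §2. A unipotent element acts trivially on a stable line -/

/-- **Unipotent on `E[N]` ⟹ character `1` on a stable line**: if `τ P = r(τ) P` for a point `P ≠ 0` of `E[N]` (`N` prime)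
and `τ (τ P − P) = τ P − P`, then `r(τ) = 1` (`(r(τ) − 1)² P = 0` with `P` of order `N`). [folklore]
[cite: Mazur1978, §5 (the isogeny character)] -/
theorem lineCharacter_eq_one_of_unipotent {F : Type*} [Field F] (W : WeierstrassCurve F) [W.IsElliptic] (N : ℕ)
    [Fact N.Prime] {P : geomTorsion W (N : ℤ)} (hP0 : P ≠ 0) {r : absoluteGaloisGroup F →* (ZMod N)ˣ}
    (hr : ∀ σ : absoluteGaloisGroup F, σ • P = ((r σ : (ZMod N)ˣ) : ZMod N).val • P)
    {τ : absoluteGaloisGroup F} (hτ : τ • (τ • P - P) = τ • P - P) : r τ = 1 := by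
  have hN : N.Prime := Fact.out
  haveI : NeZero N := ⟨hN.ne_zero⟩
  set c : ℤ := (((r τ : (ZMod N)ˣ) : ZMod N).val : ℤ) with hc
  have hτP : τ • P = c • P := by rw [hr τ, hc, natCast_zsmul]
  have hτz : ∀ (k : ℤ) (x : geomTorsion W (N : ℤ)), τ • (k • x) = k • (τ • x) := fun k x ↦
    map_zsmul (DistribSMul.toAddMonoidHom _ τ) k x
  -- `(c - 1)² • P = 0`
  have hsq : ((c - 1) * (c - 1)) • P = 0 := by
    have h1 : τ • (τ • P - P) = (c * c - c) • P := by
      rw [hτP, show c • P - P = (c - 1) • P by rw [sub_smul, one_smul], hτz, hτP, smul_smul]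
      congr 1; ring
    have h2 : τ • P - P = (c - 1) • P := by rw [hτP, sub_smul, one_smul]
    rw [h1, h2, ← sub_eq_zero, ← sub_smul] at hτ
    rw [show (c - 1) * (c - 1) = c * c - c - (c - 1) by ring]
    exact hτ
  -- the order of `P` is `N`
  have hPord : addOrderOf P = N := by
    have hNP : (N : ℤ) • P = 0 := by
      apply Subtype.ext
      have h := (mem_torsionPoints_iff _ _ (P : geomPoints W)).mp P.2
      rwa [natCast_zsmul] at h ⊢
    have hdvd : addOrderOf P ∣ N := by
      apply addOrderOf_dvd_of_nsmul_eq_zero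
      rwa [natCast_zsmul] at hNP
    rcases (Nat.dvd_prime hN).mp hdvd with h1 | h1
    · exact absurd (AddMonoid.addOrderOf_eq_one_iff.mp h1) hP0
    · exact h1
  have hdvd : (N : ℤ) ∣ (c - 1) * (c - 1) := by
    rw [← hPord]
    exact addOrderOf_dvd_iff_zsmul_eq_zero.mpr hsq
  have hdvd1 : (N : ℤ) ∣ c - 1 := by
    rcases (Int.Prime.dvd_mul' hN hdvd) with h | h <;> exact h
  ext
  rw [Units.val_one]
  have h1 : ((c : ℤ) : ZMod N) = ((1 : ℤ) : ZMod N) :=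
    (ZMod.intCast_eq_intCast_iff_dvd_sub _ _ N).mpr (by simpa using dvd_sub_comm.mp hdvd1)
  rw [hc, Int.cast_natCast, ZMod.natCast_zmod_val, Int.cast_one] at h1
  exact h1

/-! ## §3. Lemma S′ for curves with good or multiplicative reduction away from `N` -/

/-- **Lemma S′ (general prime `N`): the character of a rational `N`-line of `E/ℚ` is `χ̄_N^k` when `E` has GOOD OR
MULTIPLICATIVE reduction at every place `v ∤ N`.** At good places the character is unramified by Néron–Ogg–Shafarevich
(`Mazur1978.isogenyCharacter_eq_one_of_mem_inertia`), at multiplicative places by unipotence (§1–§2, split or not); then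
Mazur's Lemma 5.2 over `ℚ` + «`ℚ` has no unramified abelian extension» (`FullDescentLemmaS.exists_eq_modNCyclotomicCharacter_pow_of_exists_inertia`).
[cite: Mazur1978, §5 Lemma 5.2–5.3, Prop. 5.1 (pp. 149–152)] [cite: SerreInventiones1972, §1.12, §5.4] -/
theorem exists_lineCharacter_eq_pow_of_good_or_mult (W : WeierstrassCurve ℚ) [W.IsElliptic] (N : ℕ) [Fact N.Prime]
    {P : geomTorsion W (N : ℤ)} (hP0 : P ≠ 0) {r : absoluteGaloisGroup ℚ →* (ZMod N)ˣ}
    (hr : ∀ σ : absoluteGaloisGroup ℚ, σ • P = ((r σ : (ZMod N)ˣ) : ZMod N).val • P)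
    (hred : ∀ v : HeightOneSpectrum (𝓞 ℚ), (N : 𝓞 ℚ) ∉ v.asIdeal →
      W.HasGoodReductionAt v ∨ W.HasMultiplicativeReductionAt v) :
    ∃ k : ℕ, ∀ σ : absoluteGaloisGroup ℚ, r σ = modNCyclotomicCharacter ℚ N σ ^ k := by
  have hN : N.Prime := Fact.out
  refine exists_eq_modNCyclotomicCharacter_pow_of_exists_inertia N r (Mazur1978.isOpen_ker_of_smul_eq W N hP0 hr)
    fun v hv ↦ ⟨adicCompletionPrime ℚ v, adicCompletionPrime_mem_primesAbove ℚ v, fun τ hτ ↦ ?_⟩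
  rcases hred v hv with hgood | hmult
  · exact Mazur1978.isogenyCharacter_eq_one_of_mem_inertia W N hP0 hr hgood hv
      (adicCompletionPrime_mem_primesAbove ℚ v) hτ
  · exact lineCharacter_eq_one_of_unipotent W N hP0 hr
      (smul_smul_sub_eq_of_mem_inertia_geomTorsion W hmult hN hv (adicCompletionPrime_mem_primesAbove ℚ v) hτ P)

/-- **Lemma S′ at `3`: a rational `3`-line of a curve with good or multiplicative reduction at every `v ∤ 3` is the
`𝟙`-line or the `ω`-line.** [cite: Mazur1978, §5 Lemma 5.2–5.3 (pp. 149–151)] [cite: Kriz2016, Thm. 34 (1)] -/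
theorem lineCharacter_three_dichotomy_of_good_or_mult (W : WeierstrassCurve ℚ) [W.IsElliptic]
    {P : geomTorsion W ((3 : ℕ) : ℤ)} (hP0 : P ≠ 0) {r : absoluteGaloisGroup ℚ →* (ZMod 3)ˣ}
    (hr : ∀ σ : absoluteGaloisGroup ℚ, σ • P = ((r σ : (ZMod 3)ˣ) : ZMod 3).val • P)
    (hred : ∀ v : HeightOneSpectrum (𝓞 ℚ), ((3 : ℕ) : 𝓞 ℚ) ∉ v.asIdeal →
      W.HasGoodReductionAt v ∨ W.HasMultiplicativeReductionAt v) :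
    (∀ σ : absoluteGaloisGroup ℚ, r σ = 1) ∨
      (∀ σ : absoluteGaloisGroup ℚ, r σ = modNCyclotomicCharacter ℚ 3 σ) := by
  haveI : Fact (Nat.Prime 3) := ⟨Nat.prime_three⟩
  obtain ⟨k, hk⟩ := exists_lineCharacter_eq_pow_of_good_or_mult W 3 hP0 hr hred
  have hsq : ∀ u : (ZMod 3)ˣ, u ^ 2 = 1 := fun u ↦ by
    have h := ZMod.pow_totient u
    rwa [Nat.totient_prime Nat.prime_three] at h
  have hpow : ∀ u : (ZMod 3)ˣ, u ^ k = u ^ (k % 2) := fun u ↦ by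
    conv_lhs => rw [← Nat.div_add_mod k 2, pow_add, pow_mul, hsq, one_pow, one_mul]
  rcases Nat.mod_two_eq_zero_or_one k with h0 | h1
  · left
    intro σ
    rw [hk σ, hpow, h0, pow_zero]
  · right
    intro σ
    rw [hk σ, hpow, h1, pow_one]

end Summit.BirchSwinnertonDyer.BirchSwinnertonDyer.Theorems.FullDescentMultiplicativeUnipotentLine

end
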